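import Summits.ValiantsHypothesis.ValiantsHypothesis.Theorems.BarrierLeverAnchoredDoorHitsLowerPairsStarSpec

/-!
# Support item `AnchoredDoorHitsLowerPairs` (stmt-ValiantsHypothesis-22510), line `anchored-peeling`:
# MULTI-ANCHOR SPECIALISATION, part 1 (module B2a of the general-gap UQ step; blueprint HOME/val-np-p1/g19/QSTEP-BLUEPRINT ADDENDUM 3)

Helper file (`--supports stmt-ValiantsHypothesis-22510`; cell valiant-natproofs, rung V4, 𝒟-side door (c); registered line
`Cruxes/AnchoredDoorHitsLowerPairs/Lines/anchored_peeling.lean` v13; prover seat val-np-p1 gen 19). Definitions + factor lemmas; closes NO item.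

`…StarSpec` specialises ONE anchor `α⋆` to a polynomial variable `T`. The general-gap UQ step (m private anchors `β_t = (ρ_t | F)` with distinct roots) needs
`m` simultaneous variables: here a SET `𝔅` of anchors is specialised, anchor `α ∈ 𝔅` to its own variable `X α` of
`MvPolynomial (Finset (Fin h) × Finset (Fin h)) ℂ[θ,φ,ψ]` — `θ_α ↦ X α`, `φ_{α b} ↦ X α` for `b ∈ P α` (else `0`), `ψ_{α d} ↦ X α` for `d ∈ Q α` (else `0`) —
all other parameters becoming constants.

* `multiStarSpec`, `multiSpecHom`, `multiSpecHom_X`.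
* `map_multiSpecHom_symbFactor_of_not_mem` — anchors outside `𝔅` keep their factor (as a constant); `symbRestSet`, `symbolicWitness_eq_prod_mul_rest`,
  `map_multiSpecHom_symbRestSet`.
* `map_multiSpecHom_symbFactor_of_mem` — the specialised factor of `α ∈ 𝔅`:
  `1 + Σ_{Z ⊆ P α} Σ_{W ⊆ Q α} (X α)^{|Z|+|W|+1} · x^{α.1 ∪ Z} y^{α.2 ∪ W}`.
Part 2 (the entry formula for the product over `𝔅`, square-free disjointness of the used faces, top multidegree coefficients) is the successor's module B2b.

WHAT THIS IS NOT: no determinant statement yet; nothing on crux stmt-ValiantsHypothesis-14610 or on `VP` versus `VNP`.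
-/

set_option linter.dupNamespace false

namespace Summit.ValiantsHypothesis.ValiantsHypothesis.Theorems.BarrierLever.AnchoredPeeling

open Finset MvPolynomial
open Summit.ValiantsHypothesis.ValiantsHypothesis.Theorems.BarrierLever.BrickCalculus (pexpo pexpo_def pexpo_le_iff pexpo_sub)

noncomputable section

variable {h : ℕ}

/-- The target coefficient ring of the multi-anchor specialisation: one variable per anchor. -/
abbrev MultiRing (h : ℕ) : Type := MvPolynomial (Finset (Fin h) × Finset (Fin h)) (MvPolynomial (Param h) ℂ)

/-- The multi-anchor specialisation of the parameters: anchors in `𝔅` go to their own variable (twists scaled on `P α`, `Q α`, killed elsewhere), all other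
parameters become constants. -/
def multiStarSpec (𝔅 : Finset (Finset (Fin h) × Finset (Fin h))) (P Q : Finset (Fin h) × Finset (Fin h) → Finset (Fin h)) :
    Param h → MultiRing h
  | Sum.inl α => if α ∈ 𝔅 then X α else C (X (Sum.inl α))
  | Sum.inr (Sum.inl (α, b)) =>
      if α ∈ 𝔅 then (if b ∈ P α then X α else 0) else C (X (Sum.inr (Sum.inl (α, b))))
  | Sum.inr (Sum.inr (α, d)) =>
      if α ∈ 𝔅 then (if d ∈ Q α then X α else 0) else C (X (Sum.inr (Sum.inr (α, d))))

/-- The multi-anchor specialisation as a ring map `ℂ[θ,φ,ψ] → ℂ[θ,φ,ψ][X_α : α]`. -/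
def multiSpecHom (𝔅 : Finset (Finset (Fin h) × Finset (Fin h))) (P Q : Finset (Fin h) × Finset (Fin h) → Finset (Fin h)) :
    MvPolynomial (Param h) ℂ →+* MultiRing h :=
  (aeval (multiStarSpec 𝔅 P Q)).toRingHom

/-- The specialisation on a parameter variable. -/
theorem multiSpecHom_X (𝔅 : Finset (Finset (Fin h) × Finset (Fin h))) (P Q : Finset (Fin h) × Finset (Fin h) → Finset (Fin h)) (v : Param h) :
    multiSpecHom 𝔅 P Q (X v) = multiStarSpec 𝔅 P Q v := by
  rw [multiSpecHom, AlgHom.toRingHom_eq_coe, RingHom.coe_coe, aeval_X]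

variable (𝔅 : Finset (Finset (Fin h) × Finset (Fin h))) (P Q : Finset (Fin h) × Finset (Fin h) → Finset (Fin h))

/-- Anchors outside `𝔅`: their factor is unchanged (its parameters become constants). -/
theorem map_multiSpecHom_symbFactor_of_not_mem {α : Finset (Fin h) × Finset (Fin h)} (hα : α ∉ 𝔅) :
    MvPolynomial.map (multiSpecHom 𝔅 P Q) (symbFactor h α) = MvPolynomial.map C (symbFactor h α) := by
  rw [symbFactor]
  simp only [map_add, map_one, map_mul, map_prod, map_C, map_X, multiSpecHom_X, multiStarSpec, if_neg hα]

/-- The witness with the factors of `𝔅` removed. -/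
def symbRestSet (s h : ℕ) (𝔅 : Finset (Finset (Fin h) × Finset (Fin h))) : MvPolynomial (Fin (h + h)) (MvPolynomial (Param h) ℂ) :=
  ∏ α ∈ anchors s h \ 𝔅, symbFactor h α

/-- The symbolic witness splits as the product over `𝔅` times the rest (`𝔅 ⊆ anchors`). -/
theorem symbolicWitness_eq_prod_mul_rest (s h : ℕ) {𝔅 : Finset (Finset (Fin h) × Finset (Fin h))} (h𝔅 : 𝔅 ⊆ anchors s h) :
    symbolicWitness s h = (∏ α ∈ 𝔅, symbFactor h α) * symbRestSet s h 𝔅 := by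
  rw [symbolicWitness_eq_prod, symbRestSet, ← Finset.prod_union Finset.disjoint_sdiff, Finset.union_sdiff_of_subset h𝔅]

/-- The rest is unchanged by the specialisation. -/
theorem map_multiSpecHom_symbRestSet (s h : ℕ) (𝔅 : Finset (Finset (Fin h) × Finset (Fin h)))
    (P Q : Finset (Fin h) × Finset (Fin h) → Finset (Fin h)) :
    MvPolynomial.map (multiSpecHom 𝔅 P Q) (symbRestSet s h 𝔅) = MvPolynomial.map C (symbRestSet s h 𝔅) := by
  rw [symbRestSet, map_prod, map_prod]
  exact Finset.prod_congr rfl (fun α hα => map_multiSpecHom_symbFactor_of_not_mem 𝔅 P Q (Finset.mem_sdiff.mp hα).2)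

/-- A scaled twist product with a general scale `c`: the twists outside `P'` die, those inside become `1 + c·x_b`. -/
theorem prod_twist_ite {R : Type*} [CommSemiring R] (c : R) {A P' : Finset (Fin h)} (hP : P' ⊆ univ \ A) (e : Fin h → Fin (h + h)) :
    (∏ b ∈ univ \ A, (1 + C (if b ∈ P' then c else 0) * X (e b)) : MvPolynomial (Fin (h + h)) R) =
      ∏ b ∈ P', (1 + C c * X (e b)) := by
  rw [← Finset.prod_subset hP (fun b _ hbP => by rw [if_neg hbP, map_zero, zero_mul, add_zero])]
  exact Finset.prod_congr rfl (fun b hb => by rw [if_pos hb])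

/-- **The specialised factor of an anchor in `𝔅`**: `1 + Σ_{Z ⊆ P α, W ⊆ Q α} (X α)^{|Z|+|W|+1} · x^{α.1 ∪ Z} y^{α.2 ∪ W}`. -/
theorem map_multiSpecHom_symbFactor_of_mem {α : Finset (Fin h) × Finset (Fin h)} (hα : α ∈ 𝔅)
    (hP : P α ⊆ univ \ α.1) (hQ : Q α ⊆ univ \ α.2) :
    MvPolynomial.map (multiSpecHom 𝔅 P Q) (symbFactor h α) =
      1 + ∑ Z ∈ (P α).powerset, ∑ W ∈ (Q α).powerset,
        C (X α ^ (Z.card + W.card + 1)) * monomial (pexpo (α.1 ∪ Z) (α.2 ∪ W)) 1 := by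
  classical
  rw [symbFactor]
  simp only [map_add, map_one, map_mul, map_prod, map_C, map_X, multiSpecHom_X, multiStarSpec, if_pos hα]
  rw [prod_twist_ite (X α) hP, prod_twist_ite (X α) hQ, prod_one_add_C_mul_X, prod_one_add_C_mul_X,
    mul_assoc _ (∑ Z ∈ (P α).powerset, _) (∑ W ∈ (Q α).powerset, _), Finset.sum_mul_sum, Finset.mul_sum]
  congr 1
  refine Finset.sum_congr rfl (fun Z hZ => ?_)
  rw [Finset.mul_sum]
  refine Finset.sum_congr rfl (fun W hW => ?_)
  have hdA : Disjoint α.1 Z :=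
    Finset.disjoint_of_subset_right (Finset.mem_powerset.mp hZ) (Finset.disjoint_of_subset_right hP Finset.disjoint_sdiff)
  have hdB : Disjoint α.2 W :=
    Finset.disjoint_of_subset_right (Finset.mem_powerset.mp hW) (Finset.disjoint_of_subset_right hQ Finset.disjoint_sdiff)
  calc _ = (C (X α ^ Z.card) * C (X α ^ W.card) * C (X α)) *
          (((∏ a ∈ α.1, X (Fin.castAdd h a)) * ∏ b ∈ Z, X (Fin.castAdd h b)) *
           ((∏ c ∈ α.2, X (Fin.natAdd h c)) * ∏ d ∈ W, X (Fin.natAdd h d))) := by ring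
    _ = C (X α ^ (Z.card + W.card + 1)) * monomial (pexpo (α.1 ∪ Z) (α.2 ∪ W)) 1 := by
        rw [← Finset.prod_union hdA, ← Finset.prod_union hdB, prod_X_eq_monomial', prod_X_eq_monomial',
          monomial_mul, mul_one, ← pexpo_def, ← map_mul, ← map_mul, ← pow_add, ← pow_succ]

/-- Hence the specialised witness: the product of the specialised `𝔅`-factors times the constant rest. -/
theorem map_multiSpecHom_symbolicWitness (s h : ℕ) {𝔅 : Finset (Finset (Fin h) × Finset (Fin h))} (h𝔅 : 𝔅 ⊆ anchors s h)
    (P Q : Finset (Fin h) × Finset (Fin h) → Finset (Fin h)) :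
    MvPolynomial.map (multiSpecHom 𝔅 P Q) (symbolicWitness s h) =
      (∏ α ∈ 𝔅, MvPolynomial.map (multiSpecHom 𝔅 P Q) (symbFactor h α)) * MvPolynomial.map C (symbRestSet s h 𝔅) := by
  rw [symbolicWitness_eq_prod_mul_rest s h h𝔅, map_mul, map_prod, map_multiSpecHom_symbRestSet]

end

end Summit.ValiantsHypothesis.ValiantsHypothesis.Theorems.BarrierLever.AnchoredPeeling
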